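import Summits.ResolutionOfSingularities.ResolutionOfSingularities.Theorems.RadicialJungCleanModelsT2GiraudInvariantsTransport
import Literature.AlgebraicGeometry.Resolution.BlowupStalkCharts
import Literature.AlgebraicGeometry.Resolution.BlowupChartRsopIdeals
import Literature.AlgebraicGeometry.Resolution.PermissibleCentres
import Literature.AlgebraicGeometry.Resolution.StalkIdealLemmas
import Literature.AlgebraicGeometry.Resolution.StrictNormalCrossingsAt
import HarnessLib

/-!
# Route `RadicialJung`, crux `CleanModels` (stmt-15917): blowing up a closed point of a strict
# normal crossings divisor gives a strict normal crossings total transform (T2 brick B6)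

Support file (OURS) for PROGRAMME-clean-dim2 / T2 (`HOME/L/res-L0-w81-pv-2/g5/T2Skeleton.lean`,
architecture `T2-ARCHITECTURE.md` §B6: "invariants: … (*) on `E(f_n)` (B2:
`E(f_{n+1}) = e⁻¹E(f_n)`, total transform of SNC under a point blow-up at a point of the divisor
is SNC)"), line `via-clean-models` of crux `DescentPerfectToAll` (stmt-0549). Nothing here is a
statement of Hironaka's manuscript.

**Theorem** (`isStrictNormalCrossingsDivisor_preimage_of_isBlowup_point`, any dimension). Let
`Z ⊆ X` be a strict normal crossings divisor in the tree's (pointwise, Stacks 0BI9) sense, `ξ ∈ Z`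
a closed point and `π : X₁ → X` a blowing up along the reduced point `𝓘_{ξ}` (`IsBlowup`). Then
`π⁻¹(Z)` is a strict normal crossings divisor on `X₁`.

Proof. Off `ξ` the blow-up is an isomorphism over `X ∖ {ξ}` (`IsBlowup.isIso_morphismRestrict`)
and the pointwise condition is transported
(`T2.isStrictNormalCrossingsAt_preimage_iff_of_isIso_morphismRestrict`). At `x′` over `ξ`: the
condition at `ξ` gives a regular system of parameters `c = (x, y)` of `R = 𝒪_{X,ξ}` with
`I(Z)_ξ = (∏ x_t)`; `c` generates `𝓘_{ξ,ξ} = 𝔪_ξ` (`stalkIdeal_vanishingIdeal_singleton`), so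
`𝒪_{X₁,x′}` is the localisation `L` of a chart `B_i = R[𝔪/c_i]` at a prime `𝔓` over `𝔪`
(`IsBlowup.exists_reesChart_stalk`, Stacks 0804); there `c_j = c_i · e_j`, the `e_j ∉ 𝔓` are units,
and `(c_i, (e_j)_{e_j ∈ 𝔓})` is part of a regular system of parameters of `L`
(`isRsopPart_chartFamily_reesChart`, de Jong 1996, 2.4 / Stacks 0BIQ), so
`∏_t x_t = U · c_i^r · ∏_{j ∈ J} e_j` with `U` a unit and `√((∏ x_t) L) = (c_i · ∏_{j∈J} e_j)`
(`IsRsopPart.radical_span_unit_mul_prod_pow`) — the stalk of `I(π⁻¹Z)` at `x′`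
(`stalkIdeal_vanishingIdeal_preimage`: it is the radical of the extended ideal) is generated by
a product of distinct regular parameters.

* `exists_isRsopPart_radical_map_span_prod_eq` — the ring-level computation (sub-product of the
  centre's regular system of parameters; companion of
  `radical_map_span_prod_marked_mul_prod_centre` of `BlowupChartRsopIdeals.lean`);
* `isSNCIdeal_of_isRsopPart_prod` — bookkeeping `IsRsopPart ζ ⇒ IsSNCIdeal (∏ ζ)`;
* `isStrictNormalCrossingsAt_preimage_of_isBlowup_point_of_eq` — the condition at a point over
  the centre;
* `isStrictNormalCrossingsDivisor_preimage_of_isBlowup_point` — **the theorem**;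
* `isStrictNormalCrossingsDivisor_derivCriticalSet_of_isBlowup_point` — the form consumed by
  the T2 skeleton's `stub_step` (conjunct 3), with `E(π^* f) = π⁻¹E(f)` (brick B2) as a
  hypothesis.

## References
* A. J. de Jong, Smoothness, semi-stability and alterations, Publ. IHÉS 83 (1996), 2.4. [DeJong1996]
* The Stacks Project, Tags 0804, 0BI9, 0BIQ. [StacksProject]
* J. Giraud, Forme normale d'une fonction sur une surface de caractéristique positive,
  Bull. SMF 111 (1983), proof of Thm. 2.4. [Giraud1983]
-/

noncomputable section

set_option linter.dupNamespace false -- mandated namespace of this single-conjunct summit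

open CategoryTheory AlgebraicGeometry TopologicalSpace IsLocalRing
open Literature.AlgebraicGeometry.Resolution

namespace Summit.ResolutionOfSingularities.ResolutionOfSingularities.Theorems.RadicialJung.CleanModels.T2

universe u

open Scheme.IdealSheafData

/-! ## Ring level: the radical of a sub-product of the centre on a chart -/

section Ring

variable {R : Type u} [CommRing R] [IsRegularLocalRing R] {n : ℕ} (c : Fin n → R) (i : Fin n)
  (hz : Ideal.span (Set.range c) = maximalIdeal R) (hd : (maximalIdeal R).spanFinrank = n)
  (𝔓 : Ideal (chartRing c i)) [𝔓.IsPrime] (h𝔓 : 𝔓.comap (chartBase c i) = maximalIdeal R)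
  (L : Type u) [CommRing L] [IsLocalRing L] [Algebra (chartRing c i) L]
  [IsLocalization.AtPrime L 𝔓]

omit [CommRing R] [IsRegularLocalRing R] in
/-- `Fin.append c Fin.elim0` has the same range as `c`. [folklore] -/
theorem range_append_elim0 : Set.range (Fin.append c (Fin.elim0 : Fin 0 → R)) = Set.range c := by
  ext a
  constructor
  · rintro ⟨t, rfl⟩
    induction t using Fin.addCases with
    | left j => exact ⟨j, by simp⟩
    | right k => exact k.elim0
  · rintro ⟨j, rfl⟩
    exact ⟨Fin.castAdd 0 j, by simp⟩

include hz hd h𝔓 in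
/-- **The reduced total transform of a sub-product of the centre's regular system of parameters.**
Let `R` be a regular local ring with regular system of parameters `c₁, …, c_n` (generating `𝔪`),
`B = R[𝔪/cᵢ]` the chart of the blowing up of the closed point at `cᵢ`, `𝔓 ⊂ B` a prime over
`𝔪` and `L = B_𝔓`. For an injective family of indices `σ : Fin r → Fin n` with `r ≥ 1`, the
radical of the extension of `(∏_t c_{σ t})` to `L` is generated by the product of a part
`ζ = (cᵢ, (e_j)_{j ∈ J})` of a regular system of parameters of `L` (`J` = the indices
`j = σ t ≠ i` whose chart generator `e_j = c_j/cᵢ` lies in `𝔓`).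
[cite: DeJong1996, 2.4, p. 55] [cite: StacksProject, Tag 0BIQ] -/
theorem exists_isRsopPart_radical_map_span_prod_eq {r : ℕ} (σ : Fin r → Fin n)
    (hσ : Function.Injective σ) (hr : 0 < r) :
    ∃ (m : ℕ) (ζ : Fin m → L), 1 ≤ m ∧ IsRsopPart ζ ∧
      ((Ideal.span {∏ t, c (σ t)}).map
          ((algebraMap (chartRing c i) L : chartRing c i →+* L).comp (chartBase c i))).radical =
        Ideal.span {∏ s, ζ s} := by
  classical
  set aL : chartRing c i →+* L := (algebraMap (chartRing c i) L : chartRing c i →+* L) with haL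
  -- the indices `j ∈ im σ`, `j ≠ i`, with `e_j ∈ 𝔓`
  set S : Finset (Fin n) := Finset.univ.image σ with hS
  set T : Finset (Fin n) := S.filter fun j => j ≠ i ∧ chartGen c i j ∈ 𝔓 with hT
  have hTmem : ∀ {j}, j ∈ T → j ≠ i ∧ chartGen c i j ∈ 𝔓 := fun hj =>
    (Finset.mem_filter.mp hj).2
  let ι : Fin T.card ≃o ↥T := T.orderIsoOfFin rfl
  let jJ : Fin T.card → {j : Fin n // j ≠ i} := fun s => ⟨(ι s).1, (hTmem (ι s).2).1⟩
  have hjJ : Function.Injective jJ := fun s s' h => by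
    apply ι.injective
    apply Subtype.ext
    have h' : (jJ s).1 = (jJ s').1 := congrArg Subtype.val h
    exact h'
  have hJ : ∀ s, chartGen c i (jJ s).1 ∈ 𝔓 := fun s => (hTmem (ι s).2).2
  -- the regular system of parameters of `L`
  have hz' : Ideal.span (Set.range (Fin.append c (Fin.elim0 : Fin 0 → R))) = maximalIdeal R := by
    rw [range_append_elim0, hz]
  have hd' : (maximalIdeal R).spanFinrank = n + 0 := by rw [hd, Nat.add_zero]
  have hfam := isRsopPart_chartFamily_reesChart c i (Fin.elim0 : Fin 0 → R) hz' hd' 𝔓 h𝔓 L jJ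
    hjJ hJ
  -- the family `ζ = (cᵢ, (e_j)_{j ∈ T})`, re-indexed by `Fin (|T| + 1)`
  set g : Fin n → L := fun j => aL (chartGen c i j) with hg
  set X0 : L := aL (chartBase c i (c i)) with hX0
  let ζ : Fin (T.card + 1) → L := Fin.cons X0 fun s => g (jJ s).1
  have hle : T.card + 1 ≤ T.card + 0 + 1 := by omega
  have hζ : chartFamily c i (Fin.elim0 : Fin 0 → R) L (chartBase c i) (chartGen c i) jJ ∘
      Fin.castLE hle = ζ := by
    funext t
    refine Fin.cases ?_ (fun s => ?_) t
    · rfl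
    · have h1 : Fin.castLE hle s.succ = (Fin.castLE (by omega) s : Fin (T.card + 0)).succ :=
        Fin.ext (by simp)
      simp only [Function.comp_apply, h1, chartFamily, Fin.cons_succ]
      have h2 : Fin.castLE (by omega) s = (Fin.castAdd 0 s : Fin (T.card + 0)) := Fin.ext (by simp)
      rw [h2, Fin.append_left]
      rfl
  have hfamζ : IsRsopPart ζ := by
    have := hfam.comp (Fin.castLE hle) (Fin.castLE_injective hle)
    rwa [hζ] at this
  refine ⟨T.card + 1, ζ, by omega, hfamζ, ?_⟩
  -- the product computation: `∏ c_{σ t} = cᵢ^r · U · ∏_{j ∈ T} e_j`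
  have h1 : ∀ j, aL (chartBase c i (c j)) = X0 * g j := fun j => by
    rw [hX0, hg, reesChartBase_apply_eq_mul_chartGen c i j, map_mul]
  have h2 : (aL.comp (chartBase c i)) (∏ t, c (σ t)) = X0 ^ r * ∏ t, g (σ t) := by
    rw [map_prod]
    simp only [RingHom.comp_apply, h1]
    rw [Finset.prod_mul_distrib, Finset.prod_const, Finset.card_univ, Fintype.card_fin]
  have h3 : ∏ t, g (σ t) = ∏ j ∈ S, g j := by
    rw [hS, Finset.prod_image fun t _ t' _ h => hσ h]
  have h4 : ∏ j ∈ S, g j =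
      (∏ j ∈ S.filter fun j => ¬ (j ≠ i ∧ chartGen c i j ∈ 𝔓), g j) * ∏ j ∈ T, g j := by
    rw [hT, mul_comm, Finset.prod_filter_mul_prod_filter_not]
  have hU : IsUnit (∏ j ∈ S.filter fun j => ¬ (j ≠ i ∧ chartGen c i j ∈ 𝔓), g j) := by
    refine Finset.prod_induction _ IsUnit (fun a b ha hb => ha.mul hb) isUnit_one fun j hj => ?_
    rw [Finset.mem_filter] at hj
    by_cases hji : j = i
    · rw [hji, hg]
      simp only [chartGen_self c i, map_one, isUnit_one]
    · have hj𝔓 : chartGen c i j ∉ 𝔓 := fun h => hj.2 ⟨hji, h⟩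
      exact isUnit_algebraMap_chartGen c i 𝔓 L hj𝔓
  have h5 : ∏ j ∈ T, g j = ∏ s : Fin T.card, g (jJ s).1 := by
    rw [← Finset.prod_coe_sort T g]
    exact (Fintype.prod_equiv ι.toEquiv (fun s => g (jJ s).1) (fun j => g j.1) fun s => rfl).symm
  obtain ⟨U, hUu, hUdef⟩ : ∃ U : L, IsUnit U ∧
      U = ∏ j ∈ S.filter fun j => ¬ (j ≠ i ∧ chartGen c i j ∈ 𝔓), g j := ⟨_, hU, rfl⟩
  -- exponents: `r` on `cᵢ`, `1` elsewhere
  let ex : Fin (T.card + 1) → ℕ := Fin.cons r fun _ => 1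
  have hex : ∀ s, 0 < ex s := fun s => Fin.cases hr (fun _ => Nat.one_pos) s
  have hprodζ : ∏ s, ζ s ^ ex s = X0 ^ r * ∏ s : Fin T.card, g (jJ s).1 := by
    rw [Fin.prod_univ_succ]
    simp only [ζ, ex, Fin.cons_zero, Fin.cons_succ, pow_one]
  have key : (aL.comp (chartBase c i)) (∏ t, c (σ t)) = U * ∏ s, ζ s ^ ex s := by
    rw [h2, h3, h4, h5, ← hUdef, hprodζ]
    ring
  rw [Ideal.map_span, Set.image_singleton, key]
  exact hfamζ.radical_span_unit_mul_prod_pow hUu ex hex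

end Ring

/-! ## Bookkeeping: a product of a part of a regular system of parameters is an snc ideal -/

/-- If `ζ₁, …, ζ_m` (`m ≥ 1`) is part of a regular system of parameters of the local ring `A`,
then `(∏ ζ_s)` has local strict normal crossings data. [cite: StacksProject, Tag 0BI9] -/
theorem isSNCIdeal_of_isRsopPart_prod {A : Type u} [CommRing A] [IsLocalRing A] {m : ℕ}
    {ζ : Fin m → A} (hζ : IsRsopPart ζ) (hm : 1 ≤ m) {I : Ideal A}
    (hI : I = Ideal.span {∏ s, ζ s}) : IsSNCIdeal I := by
  obtain ⟨hreg, e, y, hdim, hspan⟩ := hζ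
  exact ⟨hreg, m, e, ζ, y, hm, hdim, hspan, hI⟩

/-! ## Scheme level -/

section Scheme

variable {X₁ X : Scheme.{u}} {π : X₁ ⟶ X} {Z : Set X}

/-- The closed set `π⁻¹ Z` as the preimage of the closed set `Z` in `Closeds`. -/
theorem closeds_closure_preimage_eq (hZ : IsClosed Z) :
    (⟨closure (π ⁻¹' Z), isClosed_closure⟩ : Closeds X₁) =
      (⟨Z, hZ⟩ : Closeds X).preimage π.continuous := by
  apply Closeds.ext
  simp only [Closeds.coe_mk, Closeds.coe_preimage]
  exact (hZ.preimage π.continuous).closure_eq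

/-- **The strict normal crossings condition at a point OVER the blown-up point.** Let `Z ⊆ X`
be closed with strict normal crossings at the closed point `ξ`, `π : X₁ → X` a blowing up along
the reduced point `𝓘_{ξ}`, and `x′ ∈ X₁` with `π x′ = ξ`. Then `π⁻¹ Z` has strict normal
crossings at `x′`. [cite: DeJong1996, 2.4, p. 55] [cite: StacksProject, Tag 0BIQ] -/
theorem isStrictNormalCrossingsAt_preimage_of_isBlowup_point_of_eq (hZ : IsClosed Z) {ξ : X}
    (hξ : IsClosed ({ξ} : Set X)) (hsnc : IsStrictNormalCrossingsAt X Z ξ)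
    (hπ : IsBlowup π (vanishingIdeal ⟨{ξ}, hξ⟩)) (x' : X₁) (hx' : π x' = ξ) :
    IsStrictNormalCrossingsAt X₁ (π ⁻¹' Z) x' := by
  classical
  subst hx'
  -- the data at `ξ = π x'`
  have hcl : (⟨closure Z, isClosed_closure⟩ : Closeds X) = ⟨Z, hZ⟩ := Closeds.ext hZ.closure_eq
  unfold IsStrictNormalCrossingsAt at hsnc
  rw [hcl] at hsnc
  obtain ⟨hreg, r, e, x, y, hr, hdim, hspan, hI⟩ := hsnc
  haveI := hreg
  set c : Fin (r + e) → X.presheaf.stalk (π x') := Fin.append x y with hc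
  have hrange : Set.range c = Set.range x ∪ Set.range y := by
    ext a
    constructor
    · rintro ⟨t, rfl⟩
      induction t using Fin.addCases with
      | left j => exact Or.inl ⟨j, by simp [hc]⟩
      | right k => exact Or.inr ⟨k, by simp [hc]⟩
    · rintro (⟨j, rfl⟩ | ⟨k, rfl⟩)
      · exact ⟨Fin.castAdd e j, by simp [hc]⟩
      · exact ⟨Fin.natAdd r k, by simp [hc]⟩
  have hz : Ideal.span (Set.range c) = maximalIdeal _ := by rw [hrange, hspan]
  have hd : (maximalIdeal (X.presheaf.stalk (π x'))).spanFinrank = r + e := by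
    have h := IsRegularLocalRing.spanFinrank_maximalIdeal (R := X.presheaf.stalk (π x'))
    rw [hdim] at h
    exact_mod_cast h
  have hcJ : Ideal.span (Set.range c) = stalkIdeal (vanishingIdeal ⟨{π x'}, hξ⟩) (π x') := by
    rw [hz, stalkIdeal_vanishingIdeal_singleton]
  -- the chart presentation `𝒪_{X₁,x'} = (B_i)_𝔴`
  obtain ⟨i, 𝔴, χ, hχ, hloc, h𝔴⟩ := hπ.exists_reesChart_stalk x' c hcJ
  letI := χ.toAlgebra
  haveI : IsLocalization.AtPrime (X₁.presheaf.stalk x') 𝔴.asIdeal := hloc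
  have halg : (algebraMap (chartRing c i) (X₁.presheaf.stalk x') :
      chartRing c i →+* X₁.presheaf.stalk x') = χ := rfl
  -- the ring-level computation for the sub-product `∏ x_t = ∏_t c_{castAdd e t}`
  obtain ⟨m, ζ, hm, hζ, hrad⟩ := exists_isRsopPart_radical_map_span_prod_eq c i hz hd 𝔴.asIdeal
    h𝔴 (X₁.presheaf.stalk x') (Fin.castAdd e) (Fin.castAdd_injective _ _) hr
  -- the stalk of `I(π⁻¹ Z)` at `x'` is the radical of the extended ideal
  unfold IsStrictNormalCrossingsAt
  rw [closeds_closure_preimage_eq hZ, stalkIdeal_vanishingIdeal_preimage]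
  refine isSNCIdeal_of_isRsopPart_prod hζ hm ?_
  rw [← hrad, hI]
  have hprod : ∏ t, x t = ∏ t, c (Fin.castAdd e t) := by
    simp [hc]
  have hmap : (π.stalkMap x').hom = (algebraMap (chartRing c i) (X₁.presheaf.stalk x') :
      chartRing c i →+* X₁.presheaf.stalk x').comp (chartBase c i) := by
    rw [halg]
    exact RingHom.ext fun a => (hχ a).symm
  rw [hprod, hmap]

/-- **Blowing up a closed point of a strict normal crossings divisor gives a strict normal
crossings total transform** (any dimension): for `Z ⊆ X` a strict normal crossings divisor,
`ξ ∈ Z` a closed point and `π : X₁ → X` a blowing up along `𝓘_{ξ}`, the closed set `π⁻¹(Z)` is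
a strict normal crossings divisor on `X₁`. [cite: DeJong1996, 2.4, p. 55] [cite: Giraud1983, Thm. 2.4 (proof)] -/
theorem isStrictNormalCrossingsDivisor_preimage_of_isBlowup_point
    (hZ : IsStrictNormalCrossingsDivisor X Z) {ξ : X} (hξ : IsClosed ({ξ} : Set X)) (hξZ : ξ ∈ Z)
    (hπ : IsBlowup π (vanishingIdeal ⟨{ξ}, hξ⟩)) :
    IsStrictNormalCrossingsDivisor X₁ (π ⁻¹' Z) := by
  have hZcl : IsClosed Z := hZ.isClosed
  refine IsStrictNormalCrossingsDivisor.of_forall_isStrictNormalCrossingsAt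
    (hZcl.preimage π.continuous) fun x' hx' => ?_
  by_cases h : π x' = ξ
  · exact isStrictNormalCrossingsAt_preimage_of_isBlowup_point_of_eq hZcl hξ
      (hZ.isStrictNormalCrossingsAt hξZ) hπ x' h
  · -- off the centre the blow-up is an isomorphism over `X ∖ {ξ}`
    let U : X.Opens := ⟨({ξ} : Set X)ᶜ, hξ.isOpen_compl⟩
    have hdisj : Disjoint (U : Set X) (vanishingIdeal (⟨{ξ}, hξ⟩ : Closeds X)).support := by
      rw [coe_support_vanishingIdeal]
      exact disjoint_compl_left
    haveI : IsIso (π ∣_ U) := hπ.isIso_morphismRestrict hdisj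
    have hxU : π x' ∈ U := h
    exact (isStrictNormalCrossingsAt_preimage_iff_of_isIso_morphismRestrict π U hZcl x' hxU).mpr
      (hZ.isStrictNormalCrossingsAt hx')

/-- **The form consumed by `stub_step` of the T2 skeleton (conjunct 3).** If `E(f)` is a strict
normal crossings divisor, `ξ ∈ E(f)` is closed, `π : X₁ → X` is a blowing up along `𝓘_{ξ}` and
`E(π^* f) = π⁻¹ E(f)` (brick B2), then `E(π^* f)` is a strict normal crossings divisor.
[cite: Giraud1983, Thm. 2.4 (proof)] -/
theorem isStrictNormalCrossingsDivisor_derivCriticalSet_of_isBlowup_point (f : Γ(X, ⊤))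
    (hsnc : IsStrictNormalCrossingsDivisor X (derivCriticalSet X f)) {ξ : X}
    (hξ : IsClosed ({ξ} : Set X)) (hξE : ξ ∈ derivCriticalSet X f)
    (hπ : IsBlowup π (vanishingIdeal ⟨{ξ}, hξ⟩))
    (hE : derivCriticalSet X₁ (π.appTop f) = π ⁻¹' derivCriticalSet X f) :
    IsStrictNormalCrossingsDivisor X₁ (derivCriticalSet X₁ (π.appTop f)) := by
  rw [hE]
  exact isStrictNormalCrossingsDivisor_preimage_of_isBlowup_point hsnc hξ hξE hπ

end Scheme

end Summit.ResolutionOfSingularities.ResolutionOfSingularities.Theorems.RadicialJung.CleanModels.T2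

end
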